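import Summits.Ventures.PercRepro.ProfileFlatUpset
import Summits.Ventures.PercRepro.ProfilePointedMirror

/-!
# PercRepro — (H-gen): THE MIRROR STATEMENT FOR EVERY UP-SET OF FLATS — «THE SEPARATED SETS AT LEVEL `k` ARE AT MOST
THOSE AT THE MIRROR LEVEL `n − k`» — AND THE BRIDGE (H-gen) ⟹ (H) AT MODULAR CUTS (p10, gen 26)

For a finite matroid `M` on `n` elements and an up-set `U` of its flats, gen 18's `sepSets M U` are the bi-independent
sets `Z` with `cl Z ∈ U` and `cl (E ∖ Z) ∉ U` (the sets SEPARATED by `U`), and at the modular cut of a point `p` of a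
one-element extension `M′` (`M = M′ ∖ p`, `U = modCut M′ p`) they are exactly the captured sets of `(M′, p)`
(`sepSets_delete_modCut`).  Write `s_k = sepCount M U k` for the separated sets of size `k`.

**CONJECTURE (H-gen)** (`SepMirror`, NOT asserted): for EVERY up-set `U` of flats of EVERY finite matroid on `n`
elements, `s_k ≤ s_{n−k}` for `2k < n`.  Equivalently (`upCount_eq_sepCount_add`, `upCount_mirror_eq_sepCount_add`):
`#{X ∈ BI_k : cl X ∈ U} ≤ #{X ∈ BI_{n−k} : cl X ∈ U}` — the larger side of a bi-independent partition lands its closure in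
an up-set at least as often as the smaller side; and (paper, max-flow / min-cut) a `β`-weighted normalised-matching property
between the rank-`k` and the rank-`(n−k)` flats (`β(F)` = the bases of `F` with independent complement).

* **`capCount_eq_sepCount_delete_modCut`**: `κ_k(M, p) = sepCount (M ∖ p) (modCut M p) k`;
* **`capMirror_of_sepMirror`: (H-gen) ⟹ (H)** (p5's `CapMirror`, hence `BiIndepPointed`, (C1″), (D) at the middle level of
  an even ground set — ProfilePointedMirrorLimit); `capMirrorSharp`-type sharpenings are NOT implied (and (MIRκ) is false).
* the complementation `sepCount_mirror_eq`: `#{Z ∈ BI_k : cl Z ∉ U, cl(E∖Z) ∈ U} = s_{n−k}`.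

DATA (gen 26, own exact code mining/p10/g26/): (H-gen) holds for EVERY up-set of flats of EVERY matroid with ≤ 8
elements (by the max-flow form, hflow.py: 4 / 5 / 19 / 30 / 157 / 401 `(M, k)` instances, 0 failures), every up-set
explicitly at `n ≤ 5` (hgenall.py: 21,427 up-sets at `n = 5`), every `≤ 3`-generated up-set at `n = 6, 7` (2,252,272 up-sets
at `n = 7`, 4,540,224 tests); the `n = 9` catalogue by max-flow on kit j297474.  The UNWEIGHTED form (a perfect containment
matching `BI_k → BI_{n−k}`) is FALSE (pmtest.py: `Θ₃` + chord at `n = 7`).  Nothing here asserts (H-gen), (H) or (C1″).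
-/

open scoped Matroid

namespace PercRepro.Cogirth

open Finset ThmH Skew

variable {α : Type} [DecidableEq α] {M : Matroid α} [M.Finite]

/-- `s_k`: the sets separated by `U` with `k` elements. -/
noncomputable def sepCount (M : Matroid α) [M.Finite] (U : Finset (Finset α)) (k : ℕ) : ℕ :=
  ((sepSets M U).filter (fun Z => Z.card = k)).card

/-- The bi-independent `k`-sets whose closure lies in `U`. -/
noncomputable def upCount (M : Matroid α) [M.Finite] (U : Finset (Finset α)) (k : ℕ) : ℕ :=
  ((biIndepSets M k).filter (fun X => clF M X ∈ U)).card

/-- The bi-independent `k`-sets whose closure and whose complement's closure both lie in `U`. -/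
noncomputable def bothCount (M : Matroid α) [M.Finite] (U : Finset (Finset α)) (k : ℕ) : ℕ :=
  ((biIndepSets M k).filter (fun X => clF M X ∈ U ∧ clF M (gr M \ X) ∈ U)).card

/-- **CONJECTURE (H-gen) (NOT asserted)**: for every finite matroid on `α`, every up-set `U` of its flats and every
`2k < n`, the separated sets of size `k` are at most those of size `n − k`. -/
def SepMirror (α : Type) [DecidableEq α] : Prop :=
  ∀ (M : Matroid α) [M.Finite] (U : Finset (Finset α)), UpFlats M U → ∀ k : ℕ, 2 * k < (gr M).card →
    sepCount M U k ≤ sepCount M U ((gr M).card - k)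

/-! ### The bridge to (H) -/

/-- **`κ_k = s_k` at the modular cut**: the captured `k`-sets of `(M, p)` are the sets of size `k` separated by the
modular cut of `p` in the deletion. -/
theorem capCount_eq_sepCount_delete_modCut {p : α} (hp : p ∈ gr M) (k : ℕ) :
    capCount M k p = sepCount (M ＼ ({p} : Set α)) (modCut M p) k := by
  rw [← card_capSets_filter]
  unfold sepCount
  rw [sepSets_delete_modCut hp]

/-- **(H-gen) ⟹ (H)**: apply the mirror statement to the deletion `M ∖ p` (on `N − 1` elements) at the modular cut of
`p`. -/
theorem capMirror_of_sepMirror (h : SepMirror α) : CapMirror α := by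
  intro M _ p k hp hk
  have hN := card_gr_delete (M := M) hp
  have h1 := h (M ＼ ({p} : Set α)) (modCut M p) (upFlats_modCut p) k (by rw [hN]; omega)
  rw [hN, ← capCount_eq_sepCount_delete_modCut hp, ← capCount_eq_sepCount_delete_modCut hp,
    show (gr M).card - 1 - k = (gr M).card - (k + 1) by omega] at h1
  exact h1

/-- (H-gen) ⟹ the per-point form of Theorem A. -/
theorem biIndepPointed_of_sepMirror (h : SepMirror α) : BiIndepPointed α :=
  biIndepPointed_iff_capMirror.2 (capMirror_of_sepMirror h)

/-! ### The closure-in-an-up-set form -/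

/-- A separated `k`-set is a bi-independent `k`-set whose closure is in `U` and whose complement's closure is not. -/
theorem mem_sepSets_filter_iff {U : Finset (Finset α)} {k : ℕ} {Z : Finset α} :
    Z ∈ (sepSets M U).filter (fun Z => Z.card = k) ↔
      Z ∈ biIndepSets M k ∧ clF M Z ∈ U ∧ clF M (gr M \ Z) ∉ U := by
  rw [mem_filter, mem_sepSets, mem_biIndepAll_iff, mem_biIndepSets, mem_biIndepSets]
  constructor
  · rintro ⟨⟨⟨hg, -, hr, hc⟩, hin, hout⟩, hk⟩
    exact ⟨⟨hg, hk, hr, hc⟩, hin, hout⟩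
  · rintro ⟨⟨hg, hk, hr, hc⟩, hin, hout⟩
    exact ⟨⟨⟨hg, rfl, hr, hc⟩, hin, hout⟩, hk⟩

/-- `#{X ∈ BI_k : cl X ∈ U} = s_k + both_k`. -/
theorem upCount_eq_sepCount_add (U : Finset (Finset α)) (k : ℕ) :
    upCount M U k = sepCount M U k + bothCount M U k := by
  unfold upCount bothCount
  have h := card_filter_add_card_filter_not (s := (biIndepSets M k).filter (fun X => clF M X ∈ U))
    (fun X => clF M (gr M \ X) ∉ U)
  rw [filter_filter, filter_filter] at h
  rw [← h]
  congr 1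
  · unfold sepCount
    apply congrArg Finset.card
    ext Z
    rw [mem_sepSets_filter_iff, mem_filter]
  · apply congrArg Finset.card
    apply filter_congr
    intro X _
    tauto

/-- Complementation on the bi-independent sets: `#{Z ∈ BI_k : cl Z ∉ U, cl (E ∖ Z) ∈ U} = s_{n−k}`. -/
theorem sepCount_mirror_eq (U : Finset (Finset α)) {k : ℕ} (hk : k ≤ (gr M).card) :
    ((biIndepSets M k).filter (fun Z => clF M Z ∉ U ∧ clF M (gr M \ Z) ∈ U)).card =
      sepCount M U ((gr M).card - k) := by
  unfold sepCount
  apply card_bij (fun Z _ => gr M \ Z)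
  · intro Z hZ
    rw [mem_filter] at hZ
    obtain ⟨hZb, hout, hin⟩ := hZ
    have hZg : Z ⊆ gr M := (mem_biIndepSets.1 hZb).1
    rw [mem_sepSets_filter_iff]
    refine ⟨?_, hin, ?_⟩
    · have := sdiff_mem_biIndepSets hZb
      exact this
    · rw [Finset.sdiff_sdiff_eq_self hZg]
      exact hout
  · intro Z₁ hZ₁ Z₂ hZ₂ heq
    rw [mem_filter] at hZ₁ hZ₂
    have h₁ : Z₁ ⊆ gr M := (mem_biIndepSets.1 hZ₁.1).1
    have h₂ : Z₂ ⊆ gr M := (mem_biIndepSets.1 hZ₂.1).1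
    rw [← Finset.sdiff_sdiff_eq_self h₁, ← Finset.sdiff_sdiff_eq_self h₂, heq]
  · intro Y hY
    rw [mem_sepSets_filter_iff] at hY
    obtain ⟨hYb, hin, hout⟩ := hY
    have hYg : Y ⊆ gr M := (mem_biIndepSets.1 hYb).1
    refine ⟨gr M \ Y, ?_, Finset.sdiff_sdiff_eq_self hYg⟩
    rw [mem_filter]
    refine ⟨?_, ?_, ?_⟩
    · have := sdiff_mem_biIndepSets hYb
      rwa [show (gr M).card - ((gr M).card - k) = k by omega] at this
    · exact hout
    · rw [Finset.sdiff_sdiff_eq_self hYg]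
      exact hin

/-- `#{X ∈ BI_{n−k} : cl X ∈ U} = s_{n−k} + both_k`: the «both» count is symmetric under complementation. -/
theorem upCount_mirror_eq_sepCount_add (U : Finset (Finset α)) {k : ℕ} (hk : k ≤ (gr M).card) :
    upCount M U ((gr M).card - k) = sepCount M U ((gr M).card - k) + bothCount M U k := by
  unfold upCount
  have h := card_filter_add_card_filter_not (s := (biIndepSets M k).filter (fun X => clF M (gr M \ X) ∈ U))
    (fun X => clF M X ∈ U)
  rw [filter_filter, filter_filter] at h
  have hbij : ((biIndepSets M ((gr M).card - k)).filter (fun X => clF M X ∈ U)).card =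
      ((biIndepSets M k).filter (fun X => clF M (gr M \ X) ∈ U)).card := by
    symm
    apply card_bij (fun Z _ => gr M \ Z)
    · intro Z hZ
      rw [mem_filter] at hZ ⊢
      exact ⟨sdiff_mem_biIndepSets hZ.1, hZ.2⟩
    · intro Z₁ hZ₁ Z₂ hZ₂ heq
      rw [mem_filter] at hZ₁ hZ₂
      have h₁ : Z₁ ⊆ gr M := (mem_biIndepSets.1 hZ₁.1).1
      have h₂ : Z₂ ⊆ gr M := (mem_biIndepSets.1 hZ₂.1).1
      rw [← Finset.sdiff_sdiff_eq_self h₁, ← Finset.sdiff_sdiff_eq_self h₂, heq]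
    · intro Y hY
      rw [mem_filter] at hY
      have hYg : Y ⊆ gr M := (mem_biIndepSets.1 hY.1).1
      refine ⟨gr M \ Y, ?_, Finset.sdiff_sdiff_eq_self hYg⟩
      rw [mem_filter]
      refine ⟨?_, ?_⟩
      · have := sdiff_mem_biIndepSets hY.1
        rwa [show (gr M).card - ((gr M).card - k) = k by omega] at this
      · rw [Finset.sdiff_sdiff_eq_self hYg]
        exact hY.2
  rw [hbij, ← h, ← sepCount_mirror_eq U hk, add_comm]
  unfold bothCount
  congr 1
  · apply congrArg Finset.card
    apply filter_congr
    intro X _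
    tauto
  · apply congrArg Finset.card
    apply filter_congr
    intro X _
    tauto

/-- **THE TWO FORMS OF (H-gen) AGREE**: `s_k ≤ s_{n−k}` iff `#{X ∈ BI_k : cl X ∈ U} ≤ #{X ∈ BI_{n−k} : cl X ∈ U}`. -/
theorem sepCount_le_mirror_iff_upCount_le (U : Finset (Finset α)) {k : ℕ} (hk : k ≤ (gr M).card) :
    sepCount M U k ≤ sepCount M U ((gr M).card - k) ↔ upCount M U k ≤ upCount M U ((gr M).card - k) := by
  rw [upCount_eq_sepCount_add, upCount_mirror_eq_sepCount_add U hk]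
  omega

end PercRepro.Cogirth
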